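import Summits.HodgeConjecture.HodgeConjecture.Theorems.F0P2mCadmOfCSharp              -- ★ p823508 F0P2-p01 (g6): `hdictE_of_cSharp` ((C♭) + 27455 ⟸ (C♯)hol + conj); ⊇ ★ `F0P2mE3FlatInfOfRung3`, ★ `HCCMUnconditionalH413OfF0`
import Summits.HodgeConjecture.HodgeConjecture.Theorems.F0P2mCSharpAntiholOfHol        -- ★ p823610 B-p18 (g27): conj `stubCSharpAntiholOfHol_holds : ‹StubCSharpHol› → ‹StubCSharpAntihol›`
import Literature.NumberTheory.Rogawski1990.CohomologicalFinComponentIsThetaSigned       -- ★ p824128 B-p18 (g27), director s551 (α): the (C♯)hol LETTER `cohFinComponent_isThetaSigned_hol` BY NAME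
import HarnessLib

/-!
# Crux `H413` · programme P2 — THE FLOOR-0 END STATE OF SOCKET 27455 AS ONE KERNEL SIGNATURE OVER ONE LITERATURE-NAMED LETTER:
# `hdictE_of_cohFinComponent_isThetaSigned (h : Rogawski1990.cohFinComponent_isThetaSigned_hol) : HCCMUnconditional.F0HdictE`

Cell hodgecm-mathlib (D-0151), FLOOR 0, crux item H413 = stmt-HodgeConjecture-24833; route support item `F0HdictE` = stmt-HodgeConjecture-27455.  Author F0P2-p01 (g6)
(director s551 OPTION (α) GO, 2026-08-31T13:21Z: the signed letter (C♯)hol is booked as ★ `Literature/NumberTheory/Rogawski1990/CohomologicalFinComponentIsThetaSigned.lean ::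
cohFinComponent_isThetaSigned_hol` (B-p18 (g27), p824128), body = `F0P2E3Rung3.StubCSharpHol` VERBATIM (F0P2-plan (g7) spec fe38b87c, ref1 `Iff.rfl`-grade box r132∕r135)).
THEOREMS ONLY (no `def`, no instance, no notation, no `sorry`); kernel lane `--supports stmt-HodgeConjecture-24833 --as helper`; no `Lines` import (O50-1).
HONEST LABEL: HC_CM is proved only modulo the printed citations until rung 0 closes; this file discharges nothing — it re-types the ★ two-hypothesis heads of ★ `F0P2mCadmOfCSharp` ∕ ★ `F0P2mE3FlatInfOfRung3`
on the LETTER'S NAME with B-p18 (g27)'s ★ conj closer plugged (the named `def` δ-unfolds to the pasted text, so each proof is the ★ head applied to `h`).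

* `hdictE_of_cohFinComponent_isThetaSigned (h) : …Theses.HCCMUnconditional.F0HdictE` — ROUTE ITEM 27455 MODULO EXACTLY ONE ★ LITERATURE LETTER, BY NAME;
* `H413_of_cohFinComponent_isThetaSigned (h) (hJ3a : …Theses.HCCMUnconditional.F0HJ3a) : …Theses.HCCMUnconditional.H413` — the crux modulo {(C♯)hol, 27456} (27457 ★ inside);
* `e3flatArch_of_cohFinComponent_isThetaSigned (h) : ‹E3♭∞ = F0P2E3ParityRecut.StubE3FlatArchParity VERBATIM›` — the E3 side's live `sorry` from the letter BY NAME.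
Day X: `F0HdictE_holds := hdictE_of_cohFinComponent_isThetaSigned ‹cohFinComponent_isThetaSigned_hol›_holds` closes 27455 `--workitem stmt-HodgeConjecture-27455`.
Inside (all ★, in-house): conj p823610 (B-p18), F-ISO p822962 ∕ RIG-μ p822809 (p01), RIG-ε p822973 (p02), HR-a p821653 (B-p18), (C♭) ⟸ (C♯) p823508 (p01; P3 brick I♭,
★ CI road), U2′ p798914, (D) p799091, U1′, U4 ⟸ E3♭ `F0P2fE3OfRung2`, Def. 4.12 ⟺ parity `isAdmissible_epsOf_iff_even`.

## References
* [Liu2021] Y. Liu, Camb. J. Math. 9 (2021) = arXiv:2102.11518: Prop. 4.13 and proof (Case 1, l. 2121–2147), Rem. 4.14, Def. 4.11–4.12, App. D Lem. D.1.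
* [Rogawski1990] Thm 13.3.1, 13.3.6 (c), §15.3.  [Rogawski1992] Thm 1.1.  [GelbartRogawski1991] Thm 5.1.1, Lem 5.1.2.  [FlathCorvallis1979] Thm. 3.
-/

set_option autoImplicit false

-- the mandated namespace has the single-problem summit's repeated segment (`HodgeConjecture.HodgeConjecture`)
set_option linter.dupNamespace false

noncomputable section

namespace Summit.HodgeConjecture.HodgeConjecture.Cruxes.H413.F0P2mHdictEOfLetter

-- opens: the rung-3 sub-line's (for the E3♭∞ text)
open scoped Matrix ComplexOrder
open NumberField NumberField.InfinitePlace IsDedekindDomain MeasureTheory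
open Literature.NumberTheory Literature.NumberTheory.Automorphic Literature.NumberTheory.Automorphic.UnitaryGroup
open Literature.NumberTheory.Automorphic.UnitaryGroup.CotangentForms
open Literature.NumberTheory.Automorphic.Liu2021 Literature.NumberTheory.Automorphic.Liu2021.AppendixC
open Literature.NumberTheory.Automorphic.Liu2021.Def411WeilCarriers
open Literature.NumberTheory.Automorphic.Liu2021.Def411WeilCarriersDoubling
open Literature.NumberTheory.Automorphic.IdeleClassGroup
open Literature.NumberTheory.GelbartRogawski1991 Literature.NumberTheory.GelbartRogawski1991.UnitaryDualPair
open Literature.NumberTheory.GelbartRogawski1991.UnitaryDualPair.WeilCoinv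
open Literature.RepresentationTheory Literature.RepresentationTheory.Liu2021
open Literature.NumberTheory.Rogawski1990
open Literature.NumberTheory.QuadraticForms
open Literature.AlgebraicGeometry.Liu2021 (IsAdmissibleElement)
open Summit.HodgeConjecture.CorCM
open Summit.HodgeConjecture.CorCM.Transposition

set_option synthInstance.maxHeartbeats 400000 in
set_option maxHeartbeats 16000000 in
/-- **ROUTE ITEM 27455 `HCCMUnconditional.F0HdictE` MODULO EXACTLY ONE ★ LITERATURE LETTER, BY NAME** — ★ `F0P2mCadmOfCSharp.hdictE_of_cSharp` at the named letter, conj ★ `stubCSharpAntiholOfHol_holds` plugged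
(director s551 (α)); the `def` δ-unfolds to the (C♯)hol text. [cite: Liu2021, Prop. 4.13 and proof l. 2121–2147] [cite: Rogawski1990, Thm 13.3.6 (c), §15.3]
[cite: GelbartRogawski1991, Thm 5.1.1] [cite: Rogawski1992, Thm 1.1] -/
theorem hdictE_of_cohFinComponent_isThetaSigned (h : Literature.NumberTheory.Rogawski1990.cohFinComponent_isThetaSigned_hol) :
    Summit.HodgeConjecture.HodgeConjecture.Theses.HCCMUnconditional.F0HdictE :=
  F0P2mCadmOfCSharp.hdictE_of_cSharp h F0P2mCSharpAntiholOfHol.stubCSharpAntiholOfHol_holds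

set_option synthInstance.maxHeartbeats 400000 in
set_option maxHeartbeats 16000000 in
/-- **THE CRUX `HCCMUnconditional.H413` (stmt-HodgeConjecture-24833) MODULO {the (C♯)hol LETTER, P3's socket 27456 `F0HJ3a`}** (27457 ★ inside).
HC_CM is proved only modulo the printed citations until rung 0 closes. [cite: Liu2021, Prop. 4.13, proof l. 2145] [cite: Rogawski1990, Thm. 13.3.1] -/
theorem H413_of_cohFinComponent_isThetaSigned (h : Literature.NumberTheory.Rogawski1990.cohFinComponent_isThetaSigned_hol)
    (hJ3a : Summit.HodgeConjecture.HodgeConjecture.Theses.HCCMUnconditional.F0HJ3a) :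
    Summit.HodgeConjecture.HodgeConjecture.Theses.HCCMUnconditional.H413 :=
  Summit.HodgeConjecture.HodgeConjecture.Theorems.HCCMUnconditionalH413OfF0.H413_of_F0HdictE_F0HJ3a
    (hdictE_of_cohFinComponent_isThetaSigned h) hJ3a

set_option synthInstance.maxHeartbeats 400000 in
set_option maxHeartbeats 16000000 in
/-- **E3♭∞ (= `F0P2E3ParityRecut.StubE3FlatArchParity`, the E3 side's live `sorry`) FROM THE (C♯)hol LETTER BY NAME** — fold for the E3 re-cut:
`stub_E3flatInf := F0P2mHdictEOfLetter.e3flatArch_of_cohFinComponent_isThetaSigned ‹letter›`. [cite: Liu2021, Rem. 4.14] [cite: Rogawski1992, Thm 1.1] [cite: Omeara1963, §71 Thm. 71:18] -/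
theorem e3flatArch_of_cohFinComponent_isThetaSigned (h : Literature.NumberTheory.Rogawski1990.cohFinComponent_isThetaSigned_hol) :
    ∀ (L : Type) [Field L] [NumberField L] [IsCMField L] (ι : L →+* ℂ) (H : Matrix (Fin 3) (Fin 3) L) (T : GL (Fin 3) ℂ)
      (hT : (T : Matrix (Fin 3) (Fin 3) ℂ)ᴴ * H.map ι * (T : Matrix (Fin 3) (Fin 3) ℂ) = Literature.Geometry.ComplexHyperbolic.BallModel.J),
      (∀ τ' : L →+* ℂ, InfinitePlace.mk τ' ≠ InfinitePlace.mk ι → (H.map τ').PosDef) → 2 ≤ Module.finrank ℚ ↥(maximalRealSubfield L) →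
      ∀ {n' : ℕ} (e₁ : Fin 3 × Fin 1 ≃ Fin n') (dV : Fin 3 → L) (hdV : ∀ i, IsCMField.complexConj L (dV i) = dV i)
        (hdV0 : ∀ i, dV i ≠ 0) (g : GL (Fin 3) L)
        (hg : ((g : Matrix (Fin 3) (Fin 3) L).map (cmConjRingHom L))ᵀ * H * (g : Matrix (Fin 3) (Fin 3) L) = Matrix.diagonal dV)
        (ιV : finAdelic (↥(maximalRealSubfield L)) L (IsCMField.complexConj L) 3 H →*
            finAdelic (↥(maximalRealSubfield L)) L (IsCMField.complexConj L) 3 (Matrix.diagonal dV)),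
          (∀ k, ((ιV k : finAdelic (↥(maximalRealSubfield L)) L (IsCMField.complexConj L) 3 (Matrix.diagonal dV)) :
              GL (Fin 3) (FiniteAdeleRing (𝓞 L) L)) =
            (toFinAdeleGL L 3 g)⁻¹ * (k : GL (Fin 3) (FiniteAdeleRing (𝓞 L) L)) * toFinAdeleGL L 3 g) →
          ∀ (μA : Measure (adelicGroupData (↥(maximalRealSubfield L)) L (IsCMField.complexConj L) 3 H).automorphicQuotient)
            [(adelicGroupData (↥(maximalRealSubfield L)) L (IsCMField.complexConj L) 3 H).IsAutomorphicMeasure μA],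
            ∀ P : DiscreteAutomorphicRep (adelicGroupData (↥(maximalRealSubfield L)) L (IsCMField.complexConj L) 3 H) μA,
              (P.IsHolCotangentAt (cmArchSection L ι H T hT) (cmCompactFactor L ι H T hT) ∨
                P.IsAntiholCotangentAt (cmArchSection L ι H T hT) (cmCompactFactor L ι H T hT)) →
              ∀ (μ : Literature.NumberTheory.Automorphic.IdeleClassGroup L →ₜ* Circle) (hμ : IsConjugateSymplectic L μ), HasWeight L μ 1 →
                ∀ (a : (↥(maximalRealSubfield L))ˣ) (χ : Chi (↥(maximalRealSubfield L)) L (IsCMField.complexConj L)),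
                  P.HasFinComponent
                    (rhoAtLine (↥(maximalRealSubfield L)) L (IsCMField.complexConj L) 3 e₁ (Matrix.diagonal dV)
                      (complexConj_imagUnit L) (imagUnit_ne_zero L) (imagUnit_mul_self L) (realDiagonal_isSymm L dV hdV)
                      (isUnit_det_realDiagonal L dV hdV hdV0) (realDiagonal_map L dV hdV).symm
                      (fun a => isCompatible_chiSplittingLine L e₁ dV hdV hdV0 (toHeckeCharacter L μ)
                        (isUnitary_toHeckeCharacter L μ) ((isOscillatorChar_toHeckeCharacter_iff μ).mpr hμ)
                        (TW (↥(maximalRealSubfield L)) a) (isSymm_TW (↥(maximalRealSubfield L)) a)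
                        (isUnit_det_TW (↥(maximalRealSubfield L)) a) (JW (↥(maximalRealSubfield L)) L a)
                        (JW_eq (↥(maximalRealSubfield L)) L a)) ιV a χ) →
                    Even ((Finset.univ.filter fun w : InfinitePlace ↥(maximalRealSubfield L) =>
                              InfinitePlace.embedding_of_isReal (IsTotallyReal.isReal w) (a : ↥(maximalRealSubfield L)) < 0).card +
                      {φ : L →+* ℂ | φ ∈ hμ.cmType.1 ∧ 0 < (φ (2 * imagUnit L)⁻¹).im}.ncard) :=
  F0P2mE3FlatInfOfRung3.e3flatArch_of_cSharp h F0P2mCSharpAntiholOfHol.stubCSharpAntiholOfHol_holds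

end Summit.HodgeConjecture.HodgeConjecture.Cruxes.H413.F0P2mHdictEOfLetter

end
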